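import Summits.CriticalPhenomena.SAWScalingLimit.Theses.SAWPhaseRetrieval
import Literature.Probability.LatticeModels.TriangularLatticeProofs
import Literature.Probability.Percolation.SmirnovSeparatingData

/-!
# Retrieval stability, disc case — covering bookkeeping

For the proof of `SAWPhaseRetrieval.RetrievalStabilityDisc` (stmt-CriticalPhenomena-11413):
norms of lattice points `a + b ζ` versus their integer coordinates, the decomposition of a
lattice point into (tile index, offset in the tile) by floor division, and the SCALE CHAIN lemma
(adjacent tiles share a side, so their reference lengths differ by `O(ε)`; along a chain of at
most `20` tiles the reference lengths stay within `30·n·ε` of the first one).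
-/

namespace Summit.CriticalPhenomena.SAWScalingLimit.Theorems

open Literature.Probability.LatticeModels Literature.Probability.Percolation Complex Finset

/-! ### Norms of lattice points -/

/-- `‖a + bζ‖² = a² + ab + b²` for integers `a, b`. [cite: Werner2009, §1] -/
theorem rsd_normSq_intvec (a b : ℤ) :
    Complex.normSq ((a : ℂ) + (b : ℂ) * triZeta) = (a : ℝ) ^ 2 + (a : ℝ) * b + (b : ℝ) ^ 2 := by
  have := normSq_add_mul_triZeta (a : ℝ) (b : ℝ)
  push_cast at this ⊢
  exact this

/-- If `|a|, |b|, |a+b| ≤ T` then `‖a + bζ‖ ≤ (5/4) T`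
(`a² + ab + b² = ((a+b)² + a² + b²)/2 ≤ (3/2) T²`). [folklore] -/
theorem rsd_norm_intvec_le {a b : ℤ} {T : ℝ} (ha : |(a : ℝ)| ≤ T) (hb : |(b : ℝ)| ≤ T)
    (hab : |(a : ℝ) + b| ≤ T) : ‖(a : ℂ) + (b : ℂ) * triZeta‖ ≤ 5 / 4 * T := by
  have hT : 0 ≤ T := (abs_nonneg _).trans ha
  have h1 := abs_le.1 ha; have h2 := abs_le.1 hb; have h3 := abs_le.1 hab
  have hsq : ‖(a : ℂ) + (b : ℂ) * triZeta‖ ^ 2 ≤ (5 / 4 * T) ^ 2 := by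
    rw [← Complex.normSq_eq_norm_sq, rsd_normSq_intvec]
    nlinarith [sq_abs (a : ℝ), sq_abs (b : ℝ), sq_abs ((a : ℝ) + b), sq_nonneg T,
      mul_self_le_mul_self (abs_nonneg _) ha, mul_self_le_mul_self (abs_nonneg _) hb,
      mul_self_le_mul_self (abs_nonneg _) hab]
  exact (abs_le_of_sq_le_sq' hsq (by positivity)).2

/-- Conversely, `‖a + bζ‖ ≤ R` forces `|a|, |b|, |a+b| ≤ 1.155 R` (as `3x² ≤ 4(a²+ab+b²)` for
`x ∈ {a, b, a+b}` and `4/3 < 1.155²`). [folklore] -/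
theorem rsd_coords_le_of_norm_le {a b : ℤ} {R : ℝ} (h : ‖(a : ℂ) + (b : ℂ) * triZeta‖ ≤ R) :
    |(a : ℝ)| ≤ 1.155 * R ∧ |(b : ℝ)| ≤ 1.155 * R ∧ |(a : ℝ) + b| ≤ 1.155 * R := by
  have hR : 0 ≤ R := (norm_nonneg _).trans h
  have hsq : (a : ℝ) ^ 2 + (a : ℝ) * b + (b : ℝ) ^ 2 ≤ R ^ 2 := by
    rw [← rsd_normSq_intvec, Complex.normSq_eq_norm_sq]
    exact pow_le_pow_left₀ (norm_nonneg _) h 2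
  have hc : 0 ≤ 1.155 * R := by positivity
  refine ⟨abs_le.2 (abs_le_of_sq_le_sq' ?_ hc), abs_le.2 (abs_le_of_sq_le_sq' ?_ hc),
    abs_le.2 (abs_le_of_sq_le_sq' ?_ hc)⟩
  · nlinarith [sq_nonneg ((a : ℝ) + 2 * b)]
  · nlinarith [sq_nonneg (2 * (a : ℝ) + b)]
  · nlinarith [sq_nonneg ((a : ℝ) - b)]

/-! ### Floor decomposition into tiles -/

/-- Floor decomposition of an integer with remainder in `[0, ρ)`. [folklore] -/
theorem rsd_floor_decomp (b : ℤ) {ρ : ℤ} (hρ : 0 < ρ) :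
    b = (b / ρ) * ρ + b % ρ ∧ 0 ≤ b % ρ ∧ b % ρ < ρ :=
  ⟨by rw [mul_comm]; exact (Int.mul_ediv_add_emod b ρ).symm, Int.emod_nonneg _ hρ.ne',
    Int.emod_lt_of_pos _ hρ⟩

/-- Floor quotients of integers in `[-10ρ, 10ρ)` lie in `[-10, 9]`. [folklore] -/
theorem rsd_floor_bounds {b ρ : ℤ} (hρ : 0 < ρ) (h1 : -(10 * ρ) ≤ b) (h2 : b < 10 * ρ) :
    -10 ≤ b / ρ ∧ b / ρ ≤ 9 := by
  constructor
  · have : (-10 : ℤ) * ρ ≤ b := by linarith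
    have := Int.ediv_le_ediv hρ this |> fun h => h
    calc (-10 : ℤ) = -10 * ρ / ρ := by rw [Int.mul_ediv_cancel _ hρ.ne']
      _ ≤ b / ρ := Int.ediv_le_ediv hρ (by linarith)
  · have hlt : b / ρ < 10 := by
      rw [Int.ediv_lt_iff_lt_mul hρ]; linarith
    omega

/-! ### The scale chain -/

/-- **One chain.** If consecutive terms of a non-negative sequence satisfy
`|u (k+1) - u k| ≤ 7ε (u k + u (k+1))` for `k < n ≤ 20` and `ε ≤ 1/1000`, then
`|u n - u 0| ≤ 30 n ε · u 0`. [folklore] -/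
theorem rsd_chain (u : ℕ → ℝ) {ε : ℝ} (n : ℕ) (hn : n ≤ 20) (hε : 0 ≤ ε) (hε1 : ε ≤ 1 / 1000)
    (hu : ∀ k, 0 ≤ u k) (hstep : ∀ k, k < n → |u (k + 1) - u k| ≤ 7 * ε * (u k + u (k + 1))) :
    |u n - u 0| ≤ 30 * n * ε * u 0 := by
  have main : ∀ k, k ≤ n → |u k - u 0| ≤ 30 * k * ε * u 0 := by
    intro k
    induction k with
    | zero => intro _; simp
    | succ k ih =>
      intro hk
      have ih' := ih (Nat.le_of_succ_le hk)
      have hs := hstep k hk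
      have hkR : (k : ℝ) ≤ 19 := by
        have : k + 1 ≤ 20 := hk.trans hn
        exact_mod_cast (by omega : k ≤ 19)
      have u00 := hu 0
      have uk0 := hu k
      have uk1 := hu (k + 1)
      -- u k ≤ 1.6 u 0
      have hb1 : u k ≤ u 0 + 30 * k * ε * u 0 := by have := (abs_le.1 ih').2; linarith
      have hb2 : 30 * k * ε * u 0 ≤ 0.57 * u 0 := by
        have : 30 * (k : ℝ) * ε ≤ 0.57 := by nlinarith
        exact mul_le_mul_of_nonneg_right this u00 |>.trans (by linarith)
      have hbk : u k ≤ 1.6 * u 0 := by linarith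
      -- u (k+1) ≤ 1.63 u 0
      have hs2 := (abs_le.1 hs).2
      have p1 : 7 * ε * u (k + 1) ≤ 7 / 1000 * u (k + 1) := by nlinarith
      have p2 : 7 * ε * u k ≤ 7 * ε * (1.6 * u 0) := mul_le_mul_of_nonneg_left hbk (by linarith)
      have hbk1 : u (k + 1) ≤ 1.63 * u 0 := by nlinarith
      have p3 : 7 * ε * u (k + 1) ≤ 7 * ε * (1.63 * u 0) :=
        mul_le_mul_of_nonneg_left hbk1 (by linarith)
      have hdiff : |u (k + 1) - u k| ≤ 30 * ε * u 0 := by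
        refine hs.trans ?_
        nlinarith
      calc |u (k + 1) - u 0| = |(u (k + 1) - u k) + (u k - u 0)| := by ring_nf
        _ ≤ |u (k + 1) - u k| + |u k - u 0| := abs_add_le _ _
        _ ≤ 30 * ε * u 0 + 30 * k * ε * u 0 := add_le_add hdiff ih'
        _ = 30 * ((k + 1 : ℕ) : ℝ) * ε * u 0 := by push_cast; ring
  exact main n le_rfl

/-- **Chain along an integer line.** If `v : ℤ → ℝ` is non-negative on `[lo, hi] ∋ 0` with
`|v (j+1) - v j| ≤ 7ε (v j + v (j+1))` whenever `lo ≤ j < hi`, and `hi ≤ 10`, `-10 ≤ lo`, then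
`|v j - v 0| ≤ 300 ε · v 0` for every `j ∈ [lo, hi]`. [folklore] -/
theorem rsd_line_chain (v : ℤ → ℝ) {ε : ℝ} {lo hi : ℤ} (hlo : -10 ≤ lo) (hlo0 : lo ≤ 0)
    (hhi0 : 0 ≤ hi) (hhi : hi ≤ 10) (hε : 0 ≤ ε) (hε1 : ε ≤ 1 / 1000)
    (hv : ∀ j, lo ≤ j → j ≤ hi → 0 ≤ v j)
    (hstep : ∀ j, lo ≤ j → j < hi → |v (j + 1) - v j| ≤ 7 * ε * (v j + v (j + 1)))
    (j : ℤ) (hj1 : lo ≤ j) (hj2 : j ≤ hi) : |v j - v 0| ≤ 300 * ε * v 0 := by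
  have v00 : 0 ≤ v 0 := hv 0 hlo0 hhi0
  rcases le_or_gt 0 j with hj | hj
  · -- nonnegative side: u k = v k
    obtain ⟨n, rfl⟩ := Int.eq_ofNat_of_zero_le hj
    have hn : n ≤ 10 := by exact_mod_cast hj2.trans hhi
    have key := rsd_chain (fun k => v ((k : ℕ) : ℤ) ⊔ 0) n (by omega) hε hε1 (fun k => le_sup_right)
      (fun k hk => by
        have hkZ : ((k : ℕ) : ℤ) < hi := by
          have : ((k : ℕ) : ℤ) < n := by exact_mod_cast hk
          linarith
        have e1 : v ((k : ℕ) : ℤ) ⊔ 0 = v k := sup_eq_left.2 (hv _ (by linarith) hkZ.le)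
        have e2 : v (((k + 1 : ℕ)) : ℤ) ⊔ 0 = v ((k : ℤ) + 1) := by
          push_cast; exact sup_eq_left.2 (hv _ (by linarith) (by linarith))
        simp only [e1, e2]
        exact hstep _ (by linarith) hkZ)
    simp only [Nat.cast_zero] at key
    have e0 : v 0 ⊔ 0 = v 0 := sup_eq_left.2 v00
    have en : v (n : ℤ) ⊔ 0 = v n := sup_eq_left.2 (hv _ (by linarith) hj2)
    rw [e0, en] at key
    refine key.trans ?_
    have : (30 : ℝ) * n * ε ≤ 300 * ε := by
      have : (n : ℝ) ≤ 10 := by exact_mod_cast hn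
      nlinarith
    exact mul_le_mul_of_nonneg_right this v00
  · -- negative side: u k = v (-k)
    obtain ⟨n, hn'⟩ := Int.eq_ofNat_of_zero_le (by linarith : 0 ≤ -j)
    have hjn : j = -(n : ℤ) := by linarith
    subst hjn
    have hn : n ≤ 10 := by
      have : (n : ℤ) ≤ 10 := by linarith
      exact_mod_cast this
    have key := rsd_chain (fun k => v (-((k : ℕ) : ℤ)) ⊔ 0) n (by omega) hε hε1
      (fun k => le_sup_right) (fun k hk => by
        have hkZ : lo < -((k : ℕ) : ℤ) := by
          have : ((k : ℕ) : ℤ) < n := by exact_mod_cast hk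
          linarith
        have e1 : v (-((k : ℕ) : ℤ)) ⊔ 0 = v (-(k : ℤ)) := sup_eq_left.2 (hv _ hkZ.le (by linarith))
        have e2 : v (-(((k + 1 : ℕ)) : ℤ)) ⊔ 0 = v (-(k : ℤ) - 1) := by
          push_cast
          rw [show (-((k : ℤ) + 1) : ℤ) = -(k : ℤ) - 1 by ring]
          exact sup_eq_left.2 (hv _ (by linarith) (by linarith))
        simp only [e1, e2]
        have := hstep (-(k : ℤ) - 1) (by linarith) (by linarith)
        rw [show (-(k : ℤ) - 1 + 1 : ℤ) = -(k : ℤ) by ring] at this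
        rw [abs_sub_comm]
        linarith [this])
    simp only [Nat.cast_zero, neg_zero] at key
    have e0 : v 0 ⊔ 0 = v 0 := sup_eq_left.2 v00
    have en : v (-(n : ℤ)) ⊔ 0 = v (-(n : ℤ)) := sup_eq_left.2 (hv _ hj1 hj2)
    rw [e0, en] at key
    refine key.trans ?_
    have : (30 : ℝ) * n * ε ≤ 300 * ε := by
      have : (n : ℝ) ≤ 10 := by exact_mod_cast hn
      nlinarith
    exact mul_le_mul_of_nonneg_right this v00

end Summit.CriticalPhenomena.SAWScalingLimit.Theorems
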